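import Mathlib
import Summits.MatrixMultiplication.MatrixMultiplication.Theorems.LevelGradedCohnUmansGradedPricingStubSupport
import Literature.Computability.AlgebraicComplexity.BCGPUInfiniteGroups

/-!
# `GradedPricing`, line `fourier-support-repfun`: `stub_expansion` (Fourier expansion at `1`)

Crux `stmt-MatrixMultiplication-7611` (`Summit.MatrixMultiplication.MatrixMultiplication.Theses.
LevelGradedCohnUmans.GradedPricing`), line `fourier-support-repfun`, registered stub `stub_expansion` —
the `J`-free half of the Peter–Weyl containment.  For a Wedderburn isomorphism
`φ : ℂ[G] ≃ₐ ∏ᵢ ℂ^{dᵢ×dᵢ}` and `f : G → ℂ` with inversion-twisted lift `f̌ = ∑ g, single g (f g⁻¹)`: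
if `φ(f̌)` vanishes on every block outside `{i : p i}`, then `f` is a linear combination of the
matrix coefficients `g ↦ (φ g)ᵢ[a,b]` of the blocks with `p i`, i.e. `f ∈ repFun` of those blocks
(`Literature.Computability.AlgebraicComplexity.repFun`, BCGPU 2024 Def. before Thm 2.2), the blocks
being read as `GL`-valued homomorphisms `g ↦ (φ g)ᵢ`.

Proof: Fourier inversion at `1` (tree `card_mul_coeff_one_eq_sum_trace`, through the line's
read-out identity `card_mul_apply_eq_sum_trace` landed with `stub_support`) gives
`|G| · f(g) = Σᵢ dᵢ Σ_{a,b} φ(f̌)ᵢ[b,a] · (φ g)ᵢ[a,b]`; `|G| ≠ 0` in `ℂ`; the vanishing blocks drop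
out and the remaining summands are generators of `repFun`.  Script: the planner's closed scratch of
the line (`line-fourier-support-repfun-closed.lean`, evidence on the crux item).
-/

set_option linter.dupNamespace false

noncomputable section

namespace Summit.MatrixMultiplication.MatrixMultiplication.Theorems.GradedPricing

open scoped BigOperators
open Literature.RepresentationTheory.FiniteGroups Literature.Computability.AlgebraicComplexity

variable {G : Type} [Group G]
variable {r : ℕ} {d : Fin r → ℕ}

/-- **`stub_expansion` — Fourier expansion at `1` onto the support** (crux `GradedPricing`, line
`fourier-support-repfun`).  If the Fourier transform `φ(f̌)` vanishes on every block outside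
`{i : p i}`, then `f` is a linear combination of the matrix coefficients `g ↦ (φ g)ᵢ[b,a]` of the
blocks with `p i` (as `GL`-valued homs): `|G|·f(g) = Σ_{i : p i} dᵢ Σ_{a,b} φ(f̌)ᵢ[a,b]·(φ g)ᵢ[b,a]`
(`card_mul_apply_eq_sum_trace`), `|G| ≠ 0` in `ℂ`, then `Submodule.sum_mem` / `smul_mem` /
`subset_span`.  `J`-free. -/
theorem stub_expansion {G : Type} [Group G] [Fintype G] {r : ℕ} {d : Fin r → ℕ}
    (φ : MonoidAlgebra ℂ G ≃ₐ[ℂ] Literature.RepresentationTheory.FiniteGroups.BlockAlgebraC d)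
    (p : Fin r → Prop) (f : G → ℂ)
    (hp : ∀ i, ¬ p i → φ (∑ g : G, MonoidAlgebra.single g (f g⁻¹)) i = 0) :
    f ∈ Literature.Computability.AlgebraicComplexity.repFun (fun i : {i : Fin r // p i} => d i.1)
      (fun i => ((((Pi.evalAlgHom ℂ (fun j : Fin r => Matrix (Fin (d j)) (Fin (d j)) ℂ) i.1).comp
        φ.toAlgHom).toMonoidHom).comp (MonoidAlgebra.of ℂ G)).toHomUnits) := by
  classical
  have hG : (Fintype.card G : ℂ) ≠ 0 := Nat.cast_ne_zero.mpr Fintype.card_ne_zero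
  -- Fourier expansion at `1`, as an identity of functions
  have hfun : f = ∑ i : Fin r, ∑ b : Fin (d i), ∑ a : Fin (d i),
      ((Fintype.card G : ℂ)⁻¹ * (d i : ℂ) * φ (∑ g : G, MonoidAlgebra.single g (f g⁻¹)) i b a) •
        fun g => φ (MonoidAlgebra.single g 1) i a b := by
    funext g
    simp only [Finset.sum_apply, Pi.smul_apply, smul_eq_mul]
    have h := card_mul_apply_eq_sum_trace φ f g
    have h' : f g = (Fintype.card G : ℂ)⁻¹ *
        ∑ i, (d i : ℂ) * Matrix.trace (φ (∑ h : G, MonoidAlgebra.single h (f h⁻¹)) i *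
          φ (MonoidAlgebra.single g 1) i) := by
      rw [← h, ← mul_assoc, inv_mul_cancel₀ hG, one_mul]
    rw [h', Finset.mul_sum]
    refine Finset.sum_congr rfl fun i _ => ?_
    simp only [Matrix.trace, Matrix.diag_apply, Matrix.mul_apply, Finset.mul_sum]
    refine Finset.sum_congr rfl fun b _ => Finset.sum_congr rfl fun a _ => ?_
    ring
  rw [hfun]
  refine Submodule.sum_mem _ fun i _ => Submodule.sum_mem _ fun b _ =>
    Submodule.sum_mem _ fun a _ => ?_
  by_cases hi : p i
  · refine Submodule.smul_mem _ _ (Submodule.subset_span ⟨⟨i, hi⟩, a, b, ?_⟩)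
    funext g
    rfl
  · rw [hp i hi, Matrix.zero_apply, mul_zero, zero_smul]
    exact Submodule.zero_mem _

end Summit.MatrixMultiplication.MatrixMultiplication.Theorems.GradedPricing

end
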